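import Summits.QuantumFields.QCD.Theorems.QuarksAsStableActionCriticalLineDiamagnetismEvenHalfDefs
import Summits.QuantumFields.QCD.Theorems.QuarksAsStableActionCriticalLineDiamagnetismEvenHalf
import Summits.QuantumFields.QCD.Theorems.QuarksAsStableActionCriticalLineDiamagnetismStubStaticReduction
import Summits.QuantumFields.QCD.Theorems.QuarksAsStableActionCriticalLineDiamagnetismStubStaticCovariance
import Summits.QuantumFields.QCD.Theorems.QuarksAsStableActionCriticalLineDiamagnetismStubTwoStaticGain
import Summits.QuantumFields.QCD.Theorems.QuarksAsStableActionCriticalLineDiamagnetismReduction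

/-!
# `CriticalLineDiamagnetism` — Wilson quarks are diamagnetic near `κ_c` (crux `stmt-QuantumFields-9734`, route QuarksAsStableAction) — PROVED

Sub-problem context: `Summits/QuantumFields/QCD/Statement.lean`; this file CLOSES the crux decl
`Summit.QuantumFields.QCD.Theses.QuarksAsStableAction.CriticalLineDiamagnetism` (line `Sketch`, lead c3; skeleton v26 =
`Cruxes/CriticalLineDiamagnetism/Lines/Sketch.lean`, 0 sorries).

* EVEN tori: `stub_evenHalf` (…EvenHalf.lean, p142113): chessboard estimate of the gauged Wilson determinant, cell gain by the
  one-loop Hessian margin (certificates) — computational.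
* ODD tori: the STATIC ROUTE `stub_oddHalf := stub_staticReduction (stub_staticCovariance stub_twoStaticGain)`: Lüscher transfer
  form + cyclic Hölder reduce to doubly static fields (S1, S0), whose determinant factorises over antiperiodic frequency pairs (S2);
  light frequencies are diamagnetic (S3), heavy ones GAIN by reflection positivity in frequency land + the B6 cell lemma with a
  validated-numerics certificate (S4, Route B) — computational.
* `Reduction.crux_of_halves` (tree) merges the halves with common constants.

References: E. Seiler, LNP 159 (1982); M. Lüscher, Commun. Math. Phys. 54 (1977) 283; K. Osterwalder, E. Seiler, Ann. Phys. 110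
(1978) 440; J. Fröhlich, R. Israel, E. Lieb, B. Simon, Commun. Math. Phys. 62 (1978) 1; M. Salmhofer, E. Seiler, Commun. Math.
Phys. 139 (1991) 395.
-/

noncomputable section

open scoped BigOperators Classical Matrix ComplexConjugate
open Finset
open Literature.MathematicalPhysics.QuantumLattice Literature.MathematicalPhysics.QuantumFieldTheory

namespace Summit.QuantumFields.QCD.Cruxes.CriticalLineDiamagnetism.ChessboardCellGain

/-- **The odd half** (the crux ON ODD TORI), derived from the static route:
`stub_staticReduction (stub_staticCovariance stub_twoStaticGain)`. -/
theorem stub_oddHalf :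
    ∃ ε δ c₁ K C : ℝ, 0 < ε ∧ 0 < δ ∧ 0 < c₁ ∧ ∃ L₀ : ℕ, ∀ (L : ℕ) [NeZero L], Odd L → L₀ ≤ L → let apDet : Literature.MathematicalPhysics.QuantumFieldTheory.GaugeConfig 4 L (Matrix.specialUnitaryGroup (Fin 3) ℂ) → ℝ → ℂ := fun U m => Literature.MathematicalPhysics.QuantumLattice.fermionDet (Literature.MathematicalPhysics.QuantumLattice.wilsonDirac (Literature.MathematicalPhysics.QuantumLattice.unitaryFundamentalRep (Fin 3) ℂ) (fun e => if e.1 e.2 = -1 then -(⟨(U e).1, Matrix.specialUnitaryGroup_le_unitaryGroup (U e).2⟩ : Matrix.unitaryGroup (Fin 3) ℂ) else ⟨(U e).1, Matrix.specialUnitaryGroup_le_unitaryGroup (U e).2⟩) m 1); let dfc : Literature.MathematicalPhysics.QuantumFieldTheory.GaugeConfig 4 L (Matrix.specialUnitaryGroup (Fin 3) ℂ) → Literature.MathematicalPhysics.QuantumFieldTheory.Plaquette 4 L → ℝ := fun U p => 3 - (Literature.MathematicalPhysics.QuantumLattice.fundamentalRep (Fin 3) (Literature.MathematicalPhysics.QuantumFieldTheory.plaquetteHolonomy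 U p.1 p.2.1.1 p.2.1.2)).trace.re; ∀ m : ℝ, |m| ≤ ε → ∀ U : Literature.MathematicalPhysics.QuantumFieldTheory.GaugeConfig 4 L (Matrix.specialUnitaryGroup (Fin 3) ℂ), ‖apDet U m‖ ≤ Real.exp (K - c₁ * (∑ p ∈ Finset.univ.filter (fun p => dfc U p < δ), dfc U p) + C * ((Finset.univ.filter (fun p => δ ≤ dfc U p)).card : ℝ)) * ‖apDet 1 m‖ :=
  stub_staticReduction (stub_staticCovariance stub_twoStaticGain)


/-! ## The composition: the even half and the odd half imply the crux, by name -/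

/-- **The crux from the line.** `CriticalLineDiamagnetism` from the tree theorem `stub_evenHalf` (the even half, p142113) and the odd
half `stub_oddHalf` (static route, S0–S5 all landed), merged by `crux_of_halves`. -/
theorem CriticalLineDiamagnetism_of : Theses.QuarksAsStableAction.CriticalLineDiamagnetism :=
  Reduction.crux_of_halves stub_evenHalf stub_oddHalf

end Summit.QuantumFields.QCD.Cruxes.CriticalLineDiamagnetism.ChessboardCellGain

namespace Summit.QuantumFields.QCD.Theorems

/-- **`CriticalLineDiamagnetism` (route QuarksAsStableAction, crux `stmt-QuantumFields-9734`) — PROVED.**  Wilson quarks are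
diamagnetic near `κ_c`: the antiperiodic Wilson determinant of every `SU(3)` field on `(ℤ/L)⁴`, `L ≥ L₀`, is bounded by the free one
times `exp(K − c₁ S_good + C N_bad)`.  Even `L`: chessboard estimate + one-loop margin certificates; odd `L`: the static route
(transfer-matrix reduction to doubly static fields, frequency factorisation, diamagnetism at light and reflection-positivity GAIN at
heavy frequencies).  Closing theorem of line `Sketch` (lead c3). -/
theorem CriticalLineDiamagnetism_proof : Summit.QuantumFields.QCD.Theses.QuarksAsStableAction.CriticalLineDiamagnetism :=
  Summit.QuantumFields.QCD.Cruxes.CriticalLineDiamagnetism.ChessboardCellGain.CriticalLineDiamagnetism_of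

end Summit.QuantumFields.QCD.Theorems
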